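import Summits.RiemannHypothesis.RiemannHypothesis.Theorems.TiltedLandingLaw421R3LimitMenu

/-!
# TiltedLandingLaw421R3 — «LimitMenuMargin» (W-08 C1 scratch, rh-idea-5 g41): the explicit A-side MARGIN of the limit dichotomy

Material for the E5 token (see `g41/doc/E5-ASSEMBLY-MAP.md` §3: the landed dichotomy `0 ≤ limA ∨ 0 < limT` (#1314) is leading order and
NON-STRICT on the A side, so «limit law + remainder» needs explicit slack).  Here: `limA` in completed form and, OUTSIDE C3's band
`2(1−Q)r ≤ κW`, the explicit margin `κ r (r−1)²(1−Q)² ≤ limA Q r`, strictly positive off `r = 1`, `Q = 1`; plus the elementary size bound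
`limW Q r ≤ (r+1)²`.  Pure real algebra over #1314's definitions; nothing about entire functions; sorry-free.
Nothing here bears on the truth of RH; RH is not proved; ⟨33346⟩/⟨33347⟩ OPEN.
-/

namespace RhW08.LimitMenu

section Margin

/-- `limA` in completed form: `limA Q r = Q·W·(κW − 2(1−Q)r) + κ r (r−1)²(1−Q)²`. -/
theorem limA_eq_factor (Q r : ℝ) :
    limA Q r = Q * limW Q r * (kap * limW Q r - 2 * (1 - Q) * r) + kap * r * (r - 1) ^ 2 * (1 - Q) ^ 2 := by
  unfold limA; ring

/-- the band quantity of #1314 in this file's names: `(27/256)·(r² + 1 + 2Qr) = κ·W`. -/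
theorem limBand_eq (Q r : ℝ) : (27 / 256 : ℝ) * (r ^ 2 + 1 + 2 * Q * r) = kap * limW Q r := by
  unfold kap limW; ring

/-- OUTSIDE THE BAND the A-side carries the explicit MARGIN `κ r (r−1)²(1−Q)² ≤ limA Q r` (hypothesis in #1314's literal form). -/
theorem limA_ge_margin_of_not_band (Q r : ℝ) (hQ0 : 0 ≤ Q) (hr : 0 ≤ r)
    (hnb : 2 * (1 - Q) * r ≤ (27 / 256 : ℝ) * (r ^ 2 + 1 + 2 * Q * r)) :
    kap * r * (r - 1) ^ 2 * (1 - Q) ^ 2 ≤ limA Q r := by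
  rw [limBand_eq] at hnb
  rw [limA_eq_factor]
  have hW : 0 ≤ limW Q r := (limW_pos Q r hQ0 hr).le
  nlinarith [mul_nonneg (mul_nonneg hQ0 hW) (sub_nonneg.mpr hnb)]

/-- the margin is STRICTLY positive off `r = 1` and `Q = 1` (for `0 < r`). -/
theorem limMargin_pos (Q r : ℝ) (hQ1 : Q ≠ 1) (hr : 0 < r) (hr1 : r ≠ 1) : 0 < kap * r * (r - 1) ^ 2 * (1 - Q) ^ 2 := by
  have h1 : 0 < (r - 1) ^ 2 := by positivity
  have h2 : 0 < (1 - Q) ^ 2 := by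
    have : 1 - Q ≠ 0 := sub_ne_zero.mpr (Ne.symm hQ1)
    positivity
  have hk : 0 < kap := by unfold kap; norm_num
  positivity

/-- hence OUTSIDE THE BAND and off `r = 1`, `Q = 1`: `0 < limA Q r` (strict A-disjunct). -/
theorem limA_pos_of_not_band (Q r : ℝ) (hQ0 : 0 ≤ Q) (hQ1 : Q ≠ 1) (hr : 0 < r) (hr1 : r ≠ 1)
    (hnb : 2 * (1 - Q) * r ≤ (27 / 256 : ℝ) * (r ^ 2 + 1 + 2 * Q * r)) : 0 < limA Q r :=
  lt_of_lt_of_le (limMargin_pos Q r hQ1 hr hr1) (limA_ge_margin_of_not_band Q r hQ0 hr.le hnb)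

/-- size bound `W ≤ (r+1)²` for `Q ≤ 1`, `0 ≤ r` (to turn relative remainders into absolute ones). -/
theorem limW_le_sq (Q r : ℝ) (hQ1 : Q ≤ 1) (hr : 0 ≤ r) : limW Q r ≤ (r + 1) ^ 2 := by
  unfold limW; nlinarith [mul_nonneg (sub_nonneg.mpr hQ1) hr]

/-- INSIDE THE BAND `r < 19` (the band is a bounded region of the chart; from #1314's `limBand_high` proof, restated as a lemma). -/
theorem r_lt_of_band (Q r : ℝ) (hQ0 : 0 ≤ Q) (hband : (27 / 256 : ℝ) * (r ^ 2 + 1 + 2 * Q * r) < 2 * (1 - Q) * r) : r < 19 := by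
  nlinarith [mul_nonneg hQ0 (sq_nonneg r), sq_nonneg r, mul_nonneg hQ0 hQ0]

end Margin

end RhW08.LimitMenu
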